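import Summits.NavierStokesRegularity.Statement
import Summits.NavierStokesRegularity.NavierStokesRegularity.Theorems.CertifiedBlowupCertifiedBlowupAxisymBlowupIffNotAxisymRegular

/-!
# The crux `CertifiedBlowupAxisymBlowup` (stmt-NavierStokesRegularity-0727) in terms of Kato's
# lifespan: an axisymmetric Clay datum with finite Kato maximal time

Theorems file landed `--supports stmt-NavierStokesRegularity-0727`, line `compact-amplification`
(continuation lead c1, cycle 2). The witnesses of the crux are maximal smooth Leray–Hopf solutions;
this file removes the solution objects altogether and states the crux, the conjecture ns.S25 and
the summit (A) through ONE scalar attached to the datum, Kato's maximal time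
`katoMaximalTime ν u₀ ∈ [0, ∞]` of the mild `C_t L³_x` theory:

* `katoMaximalTime_eq_of_isMaximalSmoothSolution`: the lifespan of a maximal smooth solution
  which is Leray–Hopf from its rapidly decaying datum IS the Kato maximal time of the datum
  (`≥`: landed `ofReal_le_katoMaximalTime_of_isMaximalSmoothSolution`; `≤`: a Kato solution living
  longer upgrades (von Wahl) to a Tao-class solution on a longer closed slab, which agrees with the
  maximal solution below the lifespan (Prodi–Serrin) and so continues it — absurd);
* `exists_isMaximalSmoothSolution_of_katoMaximalTime_lt_top`: conversely a smooth divergence-free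
  rapidly decaying datum with finite Kato maximal time launches a maximal Leray–Hopf classical
  solution (of lifespan exactly `T_max`);
* `katoMaximalTime_eq_top_of_global_classical`: a datum with a global classical bounded-energy
  solution has infinite Kato maximal time (exclusivity of the Clay dichotomy, X5b);
* `certifiedBlowupAxisymBlowup_iff_exists_katoMaximalTime_lt_top`:
  crux 0727 ⇔ some axisymmetric Clay datum has `T_max < ∞`;
* `axisymmetricSwirlRegularity_iff_forall_katoMaximalTime_eq_top`:
  ns.S25 ⇔ every axisymmetric Clay datum has `T_max = ∞`;
* `navierStokesRegularity_iff_forall_katoMaximalTime_eq_top`: the symmetry-free twin —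
  Clay (A) ⇔ every Clay datum has `T_max = ∞` (the crux is the axisymmetric slice of `¬(A)` in
  exactly this format).

## References

* T. Kato, Math. Z. 187 (1984), Thms. 1, 4.
* P. G. Lemarié-Rieusset, *The Navier–Stokes Problem in the 21st Century*, CRC 2016, Thm. 7.2,
  Prop. 12.3, Thm. 15.1.
* J. C. Robinson, J. L. Rodrigo, W. Sadowski, *The Three-Dimensional Navier–Stokes Equations*,
  CUP 2016, Thm. 8.19 (weak–strong uniqueness).
-/

set_option linter.dupNamespace false

noncomputable section

open MeasureTheory Set Function Filter Topology Metric
open scoped ENNReal NNReal ContDiff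

namespace Summit.NavierStokesRegularity.NavierStokesRegularity.Theorems.CertifiedBlowupAxisymBlowup.CompactAmplification

open Literature.Analysis.FluidPDE
open Summit.NavierStokesRegularity.NavierStokesRegularity.Theses.CertifiedBlowup

/-- **The lifespan of a maximal Leray–Hopf classical solution is Kato's maximal time of its
datum.** For a maximal smooth solution `(u, p)` on `[0, T)` (`ν > 0`, `T > 0`), Leray–Hopf on
`[0, T]` from the rapidly decaying datum `u 0`: `katoMaximalTime ν (u 0) = T`. The bound `T ≤ T_max`
is `ofReal_le_katoMaximalTime_of_isMaximalSmoothSolution`; if `T < T_max`, a Kato solution lives on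
some `[0, T'')`, `T'' > T`, and upgrades to a Tao-class solution `(U, P)` on `[0, T']`,
`T < T' < T''` (von Wahl, `exists_isTaoSolutionOn_of_isKatoSolutionOn`); `U = u` on `[0, T)`
(`amplificationOf_tao_eq`, Prodi–Serrin on each `[0, t']`, `t' < T`), so `U` restricted to `[0, T')`
continues `u` classically past `T` — contradicting maximality.
[cite: LemarieRieusset2016, Prop. 12.3 and Thm. 15.1] -/
theorem katoMaximalTime_eq_of_isMaximalSmoothSolution {ν T : ℝ} (hν : 0 < ν) (hT : 0 < T)
    {u : ℝ → EuclideanSpace ℝ (Fin 3) → EuclideanSpace ℝ (Fin 3)}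
    {p : ℝ → EuclideanSpace ℝ (Fin 3) → ℝ} (hmax : IsMaximalSmoothSolution ν 0 u p T)
    (hLH : IsLerayHopfOn T ν 0 (u 0) u) (hdec : HasRapidSpatialDecay (u 0)) :
    katoMaximalTime ν (u 0) = ENNReal.ofReal T := by
  refine le_antisymm ?_ (ofReal_le_katoMaximalTime_of_isMaximalSmoothSolution hν hT hmax hLH hdec)
  by_contra hlt
  rw [not_le] at hlt
  obtain ⟨T'', hTT'', U', hU'⟩ := exists_isKatoSolutionOn_of_lt_katoMaximalTime hlt
  have hTT : T < T'' := (ENNReal.ofReal_lt_ofReal_iff'.1 hTT'').1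
  set T' : ℝ := (T + T'') / 2 with hT'_def
  have hTT' : T < T' := by rw [hT'_def]; linarith
  have hT'T'' : T' < T'' := by rw [hT'_def]; linarith
  have h0T : (0 : ℝ) ∈ Ico 0 T := ⟨le_rfl, hT⟩
  have hsm : ContDiff ℝ ∞ (u 0) := hmax.1.contDiff_velocity h0T
  have hdiv : VectorCalculus.IsDivFree (u 0) := hmax.1.divFree 0 h0T
  have hdivW : NSWave0.IsDivFree (u 0) := fun x => hdiv x
  obtain ⟨U, P, hUP⟩ :=
    exists_isTaoSolutionOn_of_isKatoSolutionOn hν hsm hdivW hdec hU' (hT.trans hTT') hT'T''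
  -- `U` agrees with `u` below the lifespan
  have hagree : ∀ s ∈ Ico 0 T, U s = u s := by
    intro s hs
    set t' : ℝ := (s + T) / 2 with ht'_def
    have hst' : s < t' := by rw [ht'_def]; linarith [hs.2]
    have ht'T : t' < T := by rw [ht'_def]; linarith [hs.2]
    have ht'0 : 0 < t' := hs.1.trans_lt hst'
    exact amplificationOf_tao_eq hν hmax.1 hLH ht'0 ht'T (hUP.mono ht'0 (ht'T.le.trans hTT'.le))
      s ⟨hs.1, hst'.le⟩
  -- so `U` on `[0, T')` is a classical continuation past `T`
  exact hmax.2 ⟨T', hTT', U, P,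
    hUP.classical.mono (fun t ht => ⟨ht.1, ht.2.le⟩) (uniqueDiffOn_Ico 0 T'), hagree⟩

/-- **Finite Kato maximal time ⇒ maximal Leray–Hopf development.** A smooth, divergence-free,
rapidly decaying datum `u₀` with `katoMaximalTime ν u₀ < ∞` launches a maximal smooth solution
`(u, p)` of finite lifespan `T` (in fact `T = T_max`), Leray–Hopf on `[0, T]` from `u₀`, `u 0 = u₀`:
no Tao-class solution exists on `[0, T_max + 1]` (`clayOrBlowup_ofReal_le_katoMaximalTime`), so
`stub_maximal` applies; the lifespan is identified by `katoMaximalTime_eq_of_isMaximalSmoothSolution`.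
[cite: LemarieRieusset2016, Thm. 15.1] -/
theorem exists_isMaximalSmoothSolution_of_katoMaximalTime_lt_top {ν : ℝ} (hν : 0 < ν)
    {u₀ : EuclideanSpace ℝ (Fin 3) → EuclideanSpace ℝ (Fin 3)} (hsm : ContDiff ℝ ∞ u₀)
    (hdiv : VectorCalculus.IsDivFree u₀) (hdec : HasRapidSpatialDecay u₀)
    (hlt : katoMaximalTime ν u₀ < ⊤) :
    ∃ T : ℝ, 0 < T ∧ katoMaximalTime ν u₀ = ENNReal.ofReal T ∧
      ∃ (u : ℝ → EuclideanSpace ℝ (Fin 3) → EuclideanSpace ℝ (Fin 3))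
        (p : ℝ → EuclideanSpace ℝ (Fin 3) → ℝ),
        u 0 = u₀ ∧ IsMaximalSmoothSolution ν 0 u p T ∧ IsLerayHopfOn T ν 0 u₀ u := by
  have htop : katoMaximalTime ν u₀ ≠ ⊤ := hlt.ne
  set T₁ : ℝ := (katoMaximalTime ν u₀).toReal + 1 with hT₁_def
  have hT₁ : 0 < T₁ := by
    have h := (ENNReal.toReal_nonneg : 0 ≤ (katoMaximalTime ν u₀).toReal)
    rw [hT₁_def]; linarith
  have hno : ¬ ∃ (u : ℝ → EuclideanSpace ℝ (Fin 3) → EuclideanSpace ℝ (Fin 3))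
      (p : ℝ → EuclideanSpace ℝ (Fin 3) → ℝ), IsTaoSolutionOn T₁ ν u₀ u p := by
    rintro ⟨u, p, hup⟩
    have hle : T₁ ≤ (katoMaximalTime ν u₀).toReal :=
      (ENNReal.ofReal_le_iff_le_toReal htop).1
        (clayOrBlowup_ofReal_le_katoMaximalTime hν hT₁ hdec hup)
    rw [hT₁_def] at hle
    linarith
  obtain ⟨T, hT0, -, u, p, hu0, hmax, hLH⟩ := stub_maximal ν hν T₁ hT₁ u₀ hsm hdiv hdec hno
  refine ⟨T, hT0, ?_, u, p, hu0, hmax, hLH⟩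
  have hLH' : IsLerayHopfOn T ν 0 (u 0) u := by rw [hu0]; exact hLH
  have hdec' : HasRapidSpatialDecay (u 0) := by rw [hu0]; exact hdec
  have h := katoMaximalTime_eq_of_isMaximalSmoothSolution hν hT0 hmax hLH' hdec'
  rwa [hu0] at h

/-- **A datum with a global classical bounded-energy solution has infinite Kato maximal time**
(otherwise `exists_isMaximalSmoothSolution_of_katoMaximalTime_lt_top` gives a maximal Leray–Hopf
development of finite lifespan from the same datum, excluded by `clayOrBlowup_exclusive`, i.e. by
Clay-class uniqueness X5b). [folklore] -/
theorem katoMaximalTime_eq_top_of_global_classical {ν : ℝ} (hν : 0 < ν)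
    {u₀ : EuclideanSpace ℝ (Fin 3) → EuclideanSpace ℝ (Fin 3)} (hdec : HasRapidSpatialDecay u₀)
    {U : ℝ → EuclideanSpace ℝ (Fin 3) → EuclideanSpace ℝ (Fin 3)}
    {P : ℝ → EuclideanSpace ℝ (Fin 3) → ℝ} (hU : IsClassicalNSSolutionOn (Ici 0) ν 0 U P)
    (hU0 : U 0 = u₀) (hE : HasBoundedEnergy U) : katoMaximalTime ν u₀ = ⊤ := by
  by_contra htop
  have h0 : (0 : ℝ) ∈ Ici (0 : ℝ) := Set.mem_Ici.2 le_rfl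
  have hsm : ContDiff ℝ ∞ u₀ := by rw [← hU0]; exact hU.contDiff_velocity h0
  have hdiv : VectorCalculus.IsDivFree u₀ := by rw [← hU0]; exact hU.divFree 0 h0
  obtain ⟨T, hT, -, u, p, hu0, hmax, hLH⟩ :=
    exists_isMaximalSmoothSolution_of_katoMaximalTime_lt_top hν hsm hdiv hdec
      (lt_top_iff_ne_top.2 htop)
  exact clayOrBlowup_exclusive hν hdec hU hU0 hE hT hmax hLH hu0

/-- **The crux through Kato's lifespan.** `CertifiedBlowupAxisymBlowup` (X5a_axi) holds iff some
viscosity `ν > 0` and some smooth, divergence-free, rapidly decaying, axisymmetric datum have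
FINITE Kato maximal time. (`→`: the lifespan of the witness is `T_max`; `←`:
`exists_isMaximalSmoothSolution_of_katoMaximalTime_lt_top`.) [cite: LemarieRieusset2016, Thm. 15.1] -/
theorem certifiedBlowupAxisymBlowup_iff_exists_katoMaximalTime_lt_top :
    Summit.NavierStokesRegularity.NavierStokesRegularity.Theses.CertifiedBlowup.CertifiedBlowupAxisymBlowup ↔
      ∃ ν : ℝ, 0 < ν ∧ ∃ u₀ : EuclideanSpace ℝ (Fin 3) → EuclideanSpace ℝ (Fin 3),
        ContDiff ℝ ∞ u₀ ∧ VectorCalculus.IsDivFree u₀ ∧ HasRapidSpatialDecay u₀ ∧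
          IsAxisymmetric u₀ ∧ katoMaximalTime ν u₀ < ⊤ := by
  constructor
  · rintro ⟨ν, hν, T, hT, u, p, hmax, hLH, hdec, hax⟩
    have h0T : (0 : ℝ) ∈ Ico 0 T := ⟨le_rfl, hT⟩
    refine ⟨ν, hν, u 0, hmax.1.contDiff_velocity h0T, hmax.1.divFree 0 h0T, hdec, hax, ?_⟩
    rw [katoMaximalTime_eq_of_isMaximalSmoothSolution hν hT hmax hLH hdec]
    exact ENNReal.ofReal_lt_top
  · rintro ⟨ν, hν, u₀, hsm, hdiv, hdec, hax, hlt⟩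
    obtain ⟨T, hT, -, u, p, hu0, hmax, hLH⟩ :=
      exists_isMaximalSmoothSolution_of_katoMaximalTime_lt_top hν hsm hdiv hdec hlt
    refine ⟨ν, hν, T, hT, u, p, hmax, ?_, ?_, ?_⟩
    · rw [hu0]; exact hLH
    · rw [hu0]; exact hdec
    · rw [hu0]; exact hax

/-- **ns.S25 through Kato's lifespan.** The axisymmetric-with-swirl global regularity conjecture
`AxisymmetricSwirlRegularity` holds iff every smooth, divergence-free, rapidly decaying,
axisymmetric datum has INFINITE Kato maximal time, for every `ν > 0`. (`→`:
`katoMaximalTime_eq_top_of_global_classical`; `←`: global Kato solution ⇒ Clay solution,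
`clay_solution_of_hasGlobalKatoSolution_holds`.) [cite: LemarieRieusset2016, Prop. 12.3] -/
theorem axisymmetricSwirlRegularity_iff_forall_katoMaximalTime_eq_top :
    Literature.Analysis.FluidPDE.AxisymmetricSwirlRegularity ↔
      ∀ ν : ℝ, 0 < ν → ∀ u₀ : EuclideanSpace ℝ (Fin 3) → EuclideanSpace ℝ (Fin 3),
        ContDiff ℝ ∞ u₀ → VectorCalculus.IsDivFree u₀ → HasRapidSpatialDecay u₀ →
          IsAxisymmetric u₀ → katoMaximalTime ν u₀ = ⊤ := by
  constructor
  · intro hAX ν hν u₀ hsm hdiv hdec hax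
    obtain ⟨U, P, hU, hU0, hE⟩ := hAX ν hν u₀ hsm hdiv hdec hax
    exact katoMaximalTime_eq_top_of_global_classical hν hdec hU hU0 hE
  · intro h ν hν u₀ hsm hdiv hdec hax
    have hdivW : NSWave0.IsDivFree u₀ := fun x => hdiv x
    obtain ⟨u, p, hu, hp, hns, hbe⟩ :=
      clay_solution_of_hasGlobalKatoSolution_holds ν hν u₀ hsm hdivW hdec
        (hasGlobalKatoSolution_of_katoMaximalTime_eq_top kato_unique_holds hν
          (h ν hν u₀ hsm hdiv hdec hax))
    obtain ⟨hcl, h0⟩ := isNavierStokesSolution_and_smooth_iff.1 ⟨hns, hu, hp⟩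
    exact ⟨u, p, hcl, h0, hbe⟩

/-- **Clay (A) through Kato's lifespan** (the symmetry-free twin, for comparison: the crux is the
axisymmetric slice of its negation). `NavierStokesRegularity` — Fefferman's (A): every smooth,
divergence-free, rapidly decaying datum on `ℝ³` has a global smooth bounded-energy solution —
holds iff every such datum has infinite Kato maximal time, for every `ν > 0`.
[cite: LemarieRieusset2016, Prop. 12.3 and Thm. 15.1] -/
theorem navierStokesRegularity_iff_forall_katoMaximalTime_eq_top :
    NavierStokesRegularity ↔
      ∀ ν : ℝ, 0 < ν → ∀ u₀ : EuclideanSpace ℝ (Fin 3) → EuclideanSpace ℝ (Fin 3),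
        ContDiff ℝ ∞ u₀ → VectorCalculus.IsDivFree u₀ → HasRapidSpatialDecay u₀ →
          katoMaximalTime ν u₀ = ⊤ := by
  constructor
  · intro hA ν hν u₀ hsm hdiv hdec
    have hdivW : NSWave0.IsDivFree u₀ := fun x => hdiv x
    obtain ⟨U, P, hUs, hPs, hns, hE⟩ := hA ν hν u₀ hsm hdivW hdec
    obtain ⟨hU, hU0⟩ := isNavierStokesSolution_and_smooth_iff.1 ⟨hns, hUs, hPs⟩
    exact katoMaximalTime_eq_top_of_global_classical hν hdec hU hU0 hE
  · intro h ν hν u₀ hsm hdivW hdec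
    have hdiv : VectorCalculus.IsDivFree u₀ := fun x => hdivW x
    exact clay_solution_of_hasGlobalKatoSolution_holds ν hν u₀ hsm hdivW hdec
      (hasGlobalKatoSolution_of_katoMaximalTime_eq_top kato_unique_holds hν
        (h ν hν u₀ hsm hdiv hdec))

end Summit.NavierStokesRegularity.NavierStokesRegularity.Theorems.CertifiedBlowupAxisymBlowup.CompactAmplification

end
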